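import Mathlib
import HarnessLib
import Literature.Analysis.PDE.DivFormStrongMaximumPrinciple
import Literature.Analysis.FunctionSpaces.BMOJohnNirenberg
import Summits.NavierStokesRegularity.NavierStokesRegularity.Theorems.PoloidalWindowDoorPoloidalWindowRigidityDivFormHarnack
import Summits.NavierStokesRegularity.NavierStokesRegularity.Theorems.PoloidalWindowDoorPoloidalWindowRigidityDivFormLocalMoser
import Summits.NavierStokesRegularity.NavierStokesRegularity.Theorems.PoloidalWindowDoorPoloidalWindowRigidityDivFormLocalLogOsc

/-!
# Route `PoloidalWindowDoor`, crux K2 (stmt-NavierStokesRegularity-19708) — the two inputs of the Bombieri–Giusti lemma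
# for LOCAL weak solutions of `div(a∇w) = 0` (towards `divFormStrongMaximumPrinciple_holds`, GT 8.19)

For a `C¹` function `w ≥ 1` solving `div(a∇w) = 0` weakly against test functions supported in `U ⊇ B̄(x₀,4R)`
(hypothesis of `Literature.Analysis.PDE.divFormStrongMaximumPrinciple`), `n ≥ 3`, this file packages, in exactly the
form consumed by `Literature.Analysis.FunctionSpaces.bombieriGiusti` with `S θ = B̄(x₀, 2θR)`:

* `exists_chain_exponent_between` — admissible Moser exponents are log-dense: for every `p > 0` some
  `p₁ ∈ [p/κ, p]` of the form `κ^{j+½}` has a chain `p₁κ^k` avoiding `1` (refines `…DivFormHarnack.exists_chain_exponent`);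
* `local_sup_bound` — hypothesis (B): from `moser_chain_local` between `B̄(x₀,2θ'R) ⊂ B̄(x₀,2θR)`,
  `(m w(x)^σ)^{p₁} ≤ C₁/(θ−θ')^n · |B̄(x₀,2R)|⁻¹ ∫_{B̄(x₀,2θR)} (m w^σ)^{p₁}` for `x ∈ B̄(x₀,2θ'R)`, `σ = ±1`, `m > 0`,
  with `C₁ = C₁(n, λ, Λ)` free of `R`, `p₁`, `m`;
* `local_log_levelset` — hypothesis (A): `|{t < log f} ∩ B̄(x₀,2R)| ≤ (C_A/t)|B̄(x₀,2R)|` whenever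
  `log f ≤ |log w − (log w)_{B(x₀,2R)}|` (from `measure_ball_logOsc_gt_le_local`).

Seat ns-in-ser-b g5 (cell pub/ns-inputs), `ledger fact claim` #1 on `Literature.Analysis.PDE.divFormStrongMaximumPrinciple`.
WHAT THIS IS NOT: the Harnack inequality itself is assembled in the sequel file; nothing NS-specific, no NS statement is
touched.
-/

noncomputable section

open MeasureTheory Set Function Filter Topology Metric Module
open scoped Matrix ENNReal NNReal

-- the summit and its single sub-problem share the name (CONVENTIONS §1), as in every Theorems file
set_option linter.dupNamespace false

namespace Summit.NavierStokesRegularity.NavierStokesRegularity.Theorems.PoloidalWindowDoorPoloidalWindowRigidityDivFormLocalHarnackInputs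

open Summit.NavierStokesRegularity.NavierStokesRegularity.Theorems.PoloidalWindowDoorPoloidalWindowRigidityDivFormCaccioppoli
open Summit.NavierStokesRegularity.NavierStokesRegularity.Theorems.PoloidalWindowDoorPoloidalWindowRigidityDivFormReverseHolder
open Summit.NavierStokesRegularity.NavierStokesRegularity.Theorems.PoloidalWindowDoorPoloidalWindowRigidityDivFormMoserStep
open Summit.NavierStokesRegularity.NavierStokesRegularity.Theorems.PoloidalWindowDoorPoloidalWindowRigidityDivFormLogBMO
open Summit.NavierStokesRegularity.NavierStokesRegularity.Theorems.PoloidalWindowDoorPoloidalWindowRigidityDivFormHarnack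
open Summit.NavierStokesRegularity.NavierStokesRegularity.Theorems.PoloidalWindowDoorPoloidalWindowRigidityDivFormLocalMoser
open Summit.NavierStokesRegularity.NavierStokesRegularity.Theorems.PoloidalWindowDoorPoloidalWindowRigidityDivFormLocalLogOsc
open Literature.Analysis.FunctionSpaces

variable {n : ℕ}

/-! ### Admissible exponents are log-dense -/

/-- For `κ > 1` and `p₀ > 0` there is `p₁ ∈ [p₀/κ, p₀]` whose Moser chain `p₁κ^k` never meets `1`, with the uniform bound
`(t/(t−1))² ≤ (√κ/(√κ−1))²`, `t = p₁κ^k` (shift the exponent of `exists_chain_exponent` up by the largest admissible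
power of `κ`). -/
theorem exists_chain_exponent_between {κ : ℝ} (hκ : 1 < κ) {p₀ : ℝ} (hp₀ : 0 < p₀) :
    ∃ p₁ : ℝ, p₀ / κ ≤ p₁ ∧ p₁ ≤ p₀ ∧ ∀ k : ℕ, 1 * (p₁ * κ ^ k) ≠ 1 ∧
      (1 * (p₁ * κ ^ k) / (1 * (p₁ * κ ^ k) - 1)) ^ 2 ≤ (Real.sqrt κ / (Real.sqrt κ - 1)) ^ 2 := by
  obtain ⟨q, hq0, hqp₀, hq⟩ := exists_chain_exponent hκ hp₀
  have hκ0 : 0 < κ := zero_lt_one.trans hκ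
  -- the first `m` with `p₀ < q κ^{m+1}`
  have hex : ∃ m : ℕ, p₀ < q * κ ^ (m + 1) := by
    obtain ⟨m, hm⟩ := pow_unbounded_of_one_lt (p₀ / q) hκ
    refine ⟨m, ?_⟩
    rw [div_lt_iff₀ hq0] at hm
    calc p₀ < κ ^ m * q := hm
      _ ≤ q * κ ^ (m + 1) := by
          rw [mul_comm, pow_succ]
          exact mul_le_mul_of_nonneg_left (le_mul_of_one_le_right (pow_nonneg hκ0.le m) hκ.le) hq0.le
  classical
  set m := Nat.find hex with hm
  have hm1 : p₀ < q * κ ^ (m + 1) := Nat.find_spec hex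
  have hm0 : q * κ ^ m ≤ p₀ := by
    rcases Nat.eq_zero_or_pos m with h0 | hpos
    · rw [h0, pow_zero, mul_one]; exact hqp₀
    · have h := Nat.find_min hex (m := m - 1) (by omega)
      rw [not_lt, show m - 1 + 1 = m by omega] at h
      exact h
  refine ⟨q * κ ^ m, ?_, hm0, fun k => ?_⟩
  · rw [div_le_iff₀ hκ0, mul_assoc, ← pow_succ]; exact hm1.le
  · have h := hq (m + k)
    simp only [pow_add, one_mul, ← mul_assoc] at h ⊢
    exact h

/-! ### Hypothesis (B): the local sup bound in Bombieri–Giusti form -/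

variable {a : EuclideanSpace ℝ (Fin n) → Matrix (Fin n) (Fin n) ℝ} {lam Λ : ℝ} {w : EuclideanSpace ℝ (Fin n) → ℝ}
  {U : Set (EuclideanSpace ℝ (Fin n))}

/-- **Hypothesis (B) of the Bombieri–Giusti lemma for a local weak solution** (`n ≥ 3`): with `K` the constant of
`moser_chain_local` (for the chain bound `D` and cutoff constant `C₀`), `V₀ = |B(0,1)|` and
`C₁ = max 1 (K^{n/2} · 4^{κ/(κ−1)²} · V₀)`, for `σ = ±1`, an admissible exponent `p₁`, `m > 0`, `0 < R`,
`½ ≤ θ' < θ ≤ 1` and `B̄(x₀,2R) ⊆ U`: for every `x ∈ B̄(x₀,2θ'R)`,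
`ofReal ((m w(x)^σ)^{p₁}) ≤ ofReal (C₁/(θ−θ')^n) · |B̄(x₀,2R)|⁻¹ · ∫⁻_{B̄(x₀,2θR)} ofReal ((m w^σ)^{p₁})`. -/
theorem local_sup_bound (hn : 3 ≤ n) (hsymm : ∀ y, (a y).IsSymm) (hlam : 0 < lam)
    (hmeas : ∀ i j, Measurable fun y => a y i j)
    (hell : ∀ y (ξ : Fin n → ℝ), lam * (ξ ⬝ᵥ ξ) ≤ ξ ⬝ᵥ (a y *ᵥ ξ)) (hbd : ∀ y i j, |a y i j| ≤ Λ)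
    (hw : ContDiff ℝ 1 w) (hw1 : ∀ y, 1 ≤ w y)
    (hweak : ∀ η : EuclideanSpace ℝ (Fin n) → ℝ, ContDiff ℝ 1 η → HasCompactSupport η → tsupport η ⊆ U →
      ∫ y, ∑ i, ∑ j, a y i j * fderiv ℝ w y (EuclideanSpace.single i 1) *
        fderiv ℝ η y (EuclideanSpace.single j 1) = 0)
    {σ : ℝ} (hσ : σ = 1 ∨ σ = -1) {p₁ : ℝ} (hp₁ : 0 < p₁) {D : ℝ} (hD0 : 0 ≤ D)
    (hne : ∀ k : ℕ, σ * (p₁ * (n / (n - 2 : ℝ)) ^ k) ≠ 1)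
    (hD : ∀ k : ℕ, (σ * (p₁ * (n / (n - 2 : ℝ)) ^ k) / (σ * (p₁ * (n / (n - 2 : ℝ)) ^ k) - 1)) ^ 2 ≤ D)
    {C₀ : ℝ} (hC₀ : 0 < C₀) (hcut : ∀ (x₀ : EuclideanSpace ℝ (Fin n)) (ρ' ρ : ℝ), 0 < ρ' → ρ' < ρ →
      ∃ χ : EuclideanSpace ℝ (Fin n) → ℝ, ContDiff ℝ 1 χ ∧ HasCompactSupport χ ∧ (∀ x, 0 ≤ χ x ∧ χ x ≤ 1) ∧
        (∀ x ∈ closedBall x₀ ρ', χ x = 1) ∧ (∀ x, x ∉ ball x₀ ρ → χ x = 0) ∧ ∀ x, ‖fderiv ℝ χ x‖ ≤ C₀ / (ρ - ρ'))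
    (x₀ : EuclideanSpace ℝ (Fin n)) {R : ℝ} (hR : 0 < R) (hU : closedBall x₀ (2 * R) ⊆ U)
    {θ' θ : ℝ} (hθ' : 1 / 2 ≤ θ') (hθ'θ : θ' < θ) (hθ : θ ≤ 1) {m : ℝ} (hm : 0 < m) :
    ∀ x ∈ closedBall x₀ (2 * θ' * R),
      ENNReal.ofReal ((m * w x ^ σ) ^ p₁) ≤
        ENNReal.ofReal (max 1 (((max (eLpNormLESNormFDerivOfEqInnerConst
              (volume : Measure (EuclideanSpace ℝ (Fin n))) 2 : ℝ) 1) ^ 2 *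
              (2 * (D * (n * Λ) + lam) / lam * (4 * C₀ ^ 2))) ^ ((n : ℝ) / 2) *
            (4 : ℝ) ^ ((n / (n - 2 : ℝ)) / ((n / (n - 2 : ℝ)) - 1) ^ 2) *
            (volume (ball (0 : EuclideanSpace ℝ (Fin n)) 1)).toReal) / (θ - θ') ^ (n : ℝ)) *
          (volume (closedBall x₀ (2 * R)))⁻¹ *
          ∫⁻ y in closedBall x₀ (2 * θ * R), ENNReal.ofReal ((m * w y ^ σ) ^ p₁) := by
  intro x hx
  -- notation
  set κ : ℝ := n / (n - 2 : ℝ) with hκ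
  set K : ℝ := (max (eLpNormLESNormFDerivOfEqInnerConst (volume : Measure (EuclideanSpace ℝ (Fin n))) 2 : ℝ) 1) ^ 2 *
    (2 * (D * (n * Λ) + lam) / lam * (4 * C₀ ^ 2)) with hK
  set e₂ : ℝ := κ / (κ - 1) ^ 2 with he₂
  set V₀ : ℝ≥0∞ := volume (ball (0 : EuclideanSpace ℝ (Fin n)) 1) with hV₀
  set C₁ : ℝ := max 1 (K ^ ((n : ℝ) / 2) * (4 : ℝ) ^ e₂ * V₀.toReal) with hC₁
  set δ : ℝ := θ - θ' with hδ
  set r' : ℝ := 2 * θ' * R with hr'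
  set r : ℝ := 2 * θ * R with hr
  have hn2 : (0 : ℝ) < n - 2 := by
    have : (3 : ℝ) ≤ n := by exact_mod_cast hn
    linarith
  have hnpos : (0 : ℝ) < n := by linarith
  have hκ1 : 1 < κ := by rw [hκ, lt_div_iff₀ hn2]; linarith
  have hκ0 : 0 < κ := zero_lt_one.trans hκ1
  have he₁ : κ / (κ - 1) = (n : ℝ) / 2 := by
    rw [hκ]; field_simp; ring
  have hpos : ∀ y, 0 < w y := fun y => lt_of_lt_of_le one_pos (hw1 y)
  have hnΛ : 0 ≤ (n : ℝ) * Λ :=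
    mul_nonneg (Nat.cast_nonneg n) ((abs_nonneg _).trans (hbd x₀ ⟨0, by omega⟩ ⟨0, by omega⟩))
  have hKnn : 0 ≤ K := by rw [hK]; positivity
  have hδpos : 0 < δ := by rw [hδ]; linarith
  have hr'pos : 0 < r' := by rw [hr']; nlinarith
  have hr'r : r' < r := by rw [hr', hr]; nlinarith
  have hrr' : r - r' = 2 * R * δ := by rw [hr, hr', hδ]; ring
  have hrU : closedBall x₀ r ⊆ U := by
    refine (closedBall_subset_closedBall ?_).trans hU
    rw [hr]; nlinarith
  have hV₀0 : V₀ ≠ 0 := (measure_ball_pos volume _ one_pos).ne'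
  have hV₀t : V₀ ≠ ⊤ := measure_ball_lt_top.ne
  have hV₀r : 0 < V₀.toReal := ENNReal.toReal_pos hV₀0 hV₀t
  -- (1) the local Moser chain between `B̄(x₀,r')` and `B̄(x₀,r)`
  have hchain := moser_chain_local hn hsymm hlam hmeas hell hbd hw hw1 hweak hσ hp₁ hD0 hne hD hC₀ hcut x₀
    hr'pos hr'r hrU
  -- (2) pointwise value and the `L^{p₁}` norm as a lintegral
  set I : ℝ≥0∞ := ∫⁻ y in closedBall x₀ r, ENNReal.ofReal (w y ^ (σ * p₁)) with hI
  have hgcont : Continuous fun y => w y ^ σ := (contDiff_rpow_of_one_le hw hw1 σ).continuous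
  have hxv : ENNReal.ofReal (w x ^ σ) ≤ eLpNorm (fun y => w y ^ σ) ∞ (volume.restrict (closedBall x₀ r')) := by
    have h := enorm_le_eLpNorm_top hgcont x₀ hr'pos hx
    rwa [Real.enorm_eq_ofReal (Real.rpow_nonneg (hpos x).le _)] at h
  have hNp : eLpNorm (fun y => w y ^ σ) (ENNReal.ofReal p₁) (volume.restrict (closedBall x₀ r)) = I ^ (1 / p₁) := by
    rw [eLpNorm_rpow_eq _ hpos σ hp₁]
  -- the `p₁`-free constant `G`
  set G : ℝ≥0∞ := ENNReal.ofReal (K / (r - r') ^ 2) ^ (κ / (κ - 1)) * (4 : ℝ≥0∞) ^ e₂ with hG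
  have hstep : ENNReal.ofReal (w x ^ σ) ≤ G ^ (1 / p₁) * I ^ (1 / p₁) := by
    refine hxv.trans (hchain.trans (le_of_eq ?_))
    rw [hNp, hG, ENNReal.mul_rpow_of_nonneg _ _ (by positivity : (0 : ℝ) ≤ 1 / p₁), ← ENNReal.rpow_mul,
      ← ENNReal.rpow_mul]
    congr 2
    · congr 1; rw [hκ]; field_simp
    · congr 1; rw [he₂, hκ]; field_simp
  -- raise to the power `p₁`
  have hpow : ENNReal.ofReal (w x ^ (σ * p₁)) ≤ G * I := by
    have h := ENNReal.rpow_le_rpow hstep hp₁.le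
    rw [ENNReal.mul_rpow_of_nonneg _ _ hp₁.le, ← ENNReal.rpow_mul, ← ENNReal.rpow_mul,
      show 1 / p₁ * p₁ = 1 by field_simp, ENNReal.rpow_one, ENNReal.rpow_one,
      ENNReal.ofReal_rpow_of_pos (Real.rpow_pos_of_pos (hpos x) σ), ← Real.rpow_mul (hpos x).le] at h
    exact h
  -- (3) the constant: `G ≤ ofReal (C₁/δ^n) · |B̄(x₀,2R)|⁻¹`
  have hfin : finrank ℝ (EuclideanSpace ℝ (Fin n)) = n := finrank_euclideanSpace_fin
  have hV : volume (closedBall x₀ (2 * R)) = ENNReal.ofReal ((2 * R) ^ n) * V₀ := by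
    rw [Measure.addHaar_closedBall volume x₀ (by positivity : (0 : ℝ) ≤ 2 * R), hfin]
  have h2R : 0 < (2 * R) ^ n := by positivity
  have hGeq : G = ENNReal.ofReal (K ^ ((n : ℝ) / 2) * (4 : ℝ) ^ e₂ / δ ^ (n : ℝ) / (2 * R) ^ n) := by
    rw [hG, he₁, ENNReal.ofReal_rpow_of_nonneg (by positivity) (by positivity), hrr',
      show (4 : ℝ≥0∞) = ENNReal.ofReal 4 by norm_num, ENNReal.ofReal_rpow_of_pos (by norm_num : (0:ℝ) < 4),
      ← ENNReal.ofReal_mul (by positivity)]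
    congr 1
    rw [Real.div_rpow hKnn (sq_nonneg _), show ((2 * R * δ) ^ 2) ^ ((n : ℝ) / 2) = (2 * R) ^ n * δ ^ (n : ℝ) by
      rw [← Real.rpow_natCast (2 * R * δ) 2, ← Real.rpow_mul (by positivity),
        show ((2 : ℕ) : ℝ) * ((n : ℝ) / 2) = (n : ℝ) by push_cast; ring, Real.mul_rpow (by positivity) hδpos.le,
        Real.rpow_natCast]]
    field_simp
  have hC₁ge : K ^ ((n : ℝ) / 2) * (4 : ℝ) ^ e₂ ≤ C₁ / V₀.toReal := by
    rw [le_div_iff₀ hV₀r, hC₁]; exact le_max_right _ _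
  have hconst : G ≤ ENNReal.ofReal (C₁ / δ ^ (n : ℝ)) * (volume (closedBall x₀ (2 * R)))⁻¹ := by
    rw [hGeq, hV, ENNReal.mul_inv (Or.inl (ENNReal.ofReal_pos.2 h2R).ne') (Or.inl ENNReal.ofReal_ne_top),
      ← ENNReal.ofReal_toReal hV₀t, ← ENNReal.ofReal_inv_of_pos h2R, ← ENNReal.ofReal_inv_of_pos hV₀r,
      ← ENNReal.ofReal_mul (by positivity), ← ENNReal.ofReal_mul (by positivity)]
    refine ENNReal.ofReal_le_ofReal ?_
    have hδn : 0 < δ ^ (n : ℝ) := Real.rpow_pos_of_pos hδpos _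
    have hrhs : C₁ / δ ^ (n : ℝ) * (((2 * R) ^ n)⁻¹ * V₀.toReal⁻¹) = C₁ / V₀.toReal / δ ^ (n : ℝ) / (2 * R) ^ n := by
      field_simp
    rw [hrhs]
    exact div_le_div_of_nonneg_right (div_le_div_of_nonneg_right hC₁ge hδn.le) h2R.le
  -- (4) assemble, inserting the factor `m^{p₁}`
  have hmσ : ∀ y, (m * w y ^ σ) ^ p₁ = m ^ p₁ * w y ^ (σ * p₁) := fun y => by
    rw [Real.mul_rpow hm.le (Real.rpow_nonneg (hpos y).le _), ← Real.rpow_mul (hpos y).le]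
  have hIm : ∫⁻ y in closedBall x₀ r, ENNReal.ofReal ((m * w y ^ σ) ^ p₁) = ENNReal.ofReal (m ^ p₁) * I := by
    rw [hI, ← lintegral_const_mul' _ _ ENNReal.ofReal_ne_top]
    refine lintegral_congr fun y => ?_
    rw [hmσ, ENNReal.ofReal_mul (Real.rpow_nonneg hm.le _)]
  rw [show closedBall x₀ (2 * θ * R) = closedBall x₀ r by rw [hr], hIm, hmσ,
    ENNReal.ofReal_mul (Real.rpow_nonneg hm.le _)]
  calc ENNReal.ofReal (m ^ p₁) * ENNReal.ofReal (w x ^ (σ * p₁))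
      ≤ ENNReal.ofReal (m ^ p₁) * (G * I) := mul_le_mul' le_rfl hpow
    _ ≤ ENNReal.ofReal (m ^ p₁) * (ENNReal.ofReal (C₁ / δ ^ (n : ℝ)) * (volume (closedBall x₀ (2 * R)))⁻¹ * I) :=
        mul_le_mul' le_rfl (mul_le_mul' hconst le_rfl)
    _ = ENNReal.ofReal (C₁ / δ ^ (n : ℝ)) * (volume (closedBall x₀ (2 * R)))⁻¹ * (ENNReal.ofReal (m ^ p₁) * I) := by
        ring

/-! ### Hypothesis (A): the logarithmic level sets -/

/-- **Hypothesis (A) of the Bombieri–Giusti lemma for a local weak solution**: if `B̄(x₀,4R) ⊆ U` and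
`log f ≤ |log w − c|` pointwise, `c = (log w)_{B(x₀,2R)}`, then for `t > 0`
`|{z ∈ B̄(x₀,2R) : t < log f z}| ≤ ((K+1)/t) |B̄(x₀,2R)|`, `K = 16·4ⁿ nΛC₀²/λ` (`C₀` a ball-cutoff constant). -/
theorem local_log_levelset (hsymm : ∀ y, (a y).IsSymm) (hlam : 0 < lam)
    (hmeas : ∀ i j, Measurable fun y => a y i j)
    (hell : ∀ y (ξ : Fin n → ℝ), lam * (ξ ⬝ᵥ ξ) ≤ ξ ⬝ᵥ (a y *ᵥ ξ)) (hbd : ∀ y i j, |a y i j| ≤ Λ)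
    (hw : ContDiff ℝ 1 w) (hw1 : ∀ y, 1 ≤ w y)
    (hweak : ∀ η : EuclideanSpace ℝ (Fin n) → ℝ, ContDiff ℝ 1 η → HasCompactSupport η → tsupport η ⊆ U →
      ∫ y, ∑ i, ∑ j, a y i j * fderiv ℝ w y (EuclideanSpace.single i 1) *
        fderiv ℝ η y (EuclideanSpace.single j 1) = 0)
    {C₀ : ℝ}
    (hcut : ∀ (x₀ : EuclideanSpace ℝ (Fin n)) (r : ℝ), 0 < r →
      ∃ χ : EuclideanSpace ℝ (Fin n) → ℝ, ContDiff ℝ 1 χ ∧ HasCompactSupport χ ∧ (∀ x, 0 ≤ χ x ∧ χ x ≤ 1) ∧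
        (∀ x ∈ ball x₀ r, χ x = 1) ∧ (∀ x, x ∉ ball x₀ (2 * r) → χ x = 0) ∧ ∀ x, ‖fderiv ℝ χ x‖ ≤ C₀ / r)
    (x₀ : EuclideanSpace ℝ (Fin n)) {R : ℝ} (hR : 0 < R) (hU : closedBall x₀ (4 * R) ⊆ U)
    {f : EuclideanSpace ℝ (Fin n) → ℝ}
    (hf : ∀ z, Real.log (f z) ≤ |Real.log (w z) - ⨍ y in ball x₀ (2 * R), Real.log (w y)|) {t : ℝ} (ht : 0 < t) :
    volume {z ∈ closedBall x₀ (2 * R) | t < Real.log (f z)} ≤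
      ENNReal.ofReal ((16 * 4 ^ n * (n * Λ) * C₀ ^ 2 / lam + 1) / t) * volume (closedBall x₀ (2 * R)) := by
  have h2R : 0 < 2 * R := by positivity
  have hU' : closedBall x₀ (2 * (2 * R)) ⊆ U := by rw [show 2 * (2 * R) = 4 * R by ring]; exact hU
  have hD := measure_ball_logOsc_gt_le_local hsymm hlam hmeas hell hbd hw hw1 hweak hcut x₀ h2R hU' ht
  rw [JohnNirenberg.volume_closedBall_eq_volume_ball x₀ h2R]
  refine le_trans ?_ hD
  -- closed ball versus open ball: a null sphere
  have hae := JohnNirenberg.closedBall_ae_eq_ball (E := EuclideanSpace ℝ (Fin n)) x₀ h2R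
  have hsub : {z ∈ closedBall x₀ (2 * R) | t < Real.log (f z)} ⊆
      {z ∈ ball x₀ (2 * R) | t < |Real.log (w z) - ⨍ y in ball x₀ (2 * R), Real.log (w y)|} ∪
        (closedBall x₀ (2 * R) \ ball x₀ (2 * R)) := by
    intro z hz
    by_cases hzb : z ∈ ball x₀ (2 * R)
    · exact Or.inl ⟨hzb, hz.2.trans_le (hf z)⟩
    · exact Or.inr ⟨hz.1, hzb⟩
  refine (measure_mono hsub).trans ((measure_union_le _ _).trans ?_)
  have h0 : volume (closedBall x₀ (2 * R) \ ball x₀ (2 * R)) = 0 := (ae_eq_set.1 hae).1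
  rw [h0, add_zero]

end Summit.NavierStokesRegularity.NavierStokesRegularity.Theorems.PoloidalWindowDoorPoloidalWindowRigidityDivFormLocalHarnackInputs

end
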